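import Mathlib
import Literature.Analysis.FluidPDE.NormalisedPressureL2Bound
import Literature.Analysis.FluidPDE.PressureRepresentation
import Literature.Analysis.FluidPDE.FlatSwirlGauge
import Literature.Analysis.FluidPDE.NewtonPotential
import Literature.Analysis.FluidPDE.RieszPressureLocality
import Summits.NavierStokesRegularity.NavierStokesRegularity.Theorems.EulerZoomLiouvillePowerGaugeEulerLiouvilleSelfSimilarEndpointPressureMid
import HarnessLib

/-!
# Rung C1 of the crux `EulerZoomLiouville.PowerGaugeEulerLiouville`: the scale-wise Riesz
# pressure `Q_R = Π[V·1_{B_R}] + ∫_{|z| ≥ R} K(·−z)(V z) dz` of an `L² ∩ L³_loc` field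

Route №10 `EulerZoomLiouville` (NavierStokesRegularity), crux E = stmt-NavierStokesRegularity-19832,
rung C1 at the endpoint.  The endpoint stratum (`…SelfSimilarEndpointMember`) assumes that the
pressure profile is, below `|y| < R/2`, the Riesz pressure of the near field `V·1_{B_R}` plus the
honest kernel integral of the far field.  For `V ∈ L²` only (no global `L³`) this scale-wise object
is the substitute for the whole-space Riesz pressure; this file proves its two structural
properties, for `V ∈ L² ∩ L³_loc`:

* `aestronglyMeasurable_farIntegral` — the far integral is a.e.-strongly measurable in `y`;
* `integral_pressureKernel_mul_laplacian_eq_zero_of_far`, `integral_farIntegral_mul_laplacian_eq_zero`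
  — the far integral is WEAKLY HARMONIC on `B_{R/2}` (the kernel `K(·−z)(v) = −∂ᵥ∂ᵥΓ(·−z)` is a
  second derivative of the tree's regularised Newton kernel `Φ_ε`, harmonic off `B(z, ε)`);
* `integral_scaleQ_mul_laplacian` — `Q_R` solves the weak Poisson equation
  `∫ Q_R Δθ = −∫ D²θ(V,V)` for test functions supported in `B_{R/2}`;
* (sequel `…RieszScaleConsistency`: `Q_R = Q_{R'}` a.e. on `B_{R/2}` for `R ≤ R'`).

WHAT THIS IS NOT: not NS, not E, not rung C1 — harmonic-analysis plumbing; the identification of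
the pressure profile with `Q_R` is the sequel.
-/

noncomputable section

-- flat `Theorems/<Route><Decl>…` files of one crux share the namespace of the crux (tree convention)
set_option linter.dupNamespace false

open MeasureTheory Set Filter Topology Metric Function TopologicalSpace InnerProductSpace
open scoped ENNReal NNReal InnerProductSpace RealInnerProductSpace Laplacian

namespace Summit.NavierStokesRegularity.NavierStokesRegularity.Theorems.PowerGaugeEulerLiouville

open Literature.Analysis Literature.Analysis.FunctionSpaces Literature.Analysis.FluidPDE

variable {V : EuclideanSpace ℝ (Fin 3) → EuclideanSpace ℝ (Fin 3)}

section Measurability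

/-- **The far integral `y ↦ ∫_S K(y−z)(V z) dz` is a.e.-strongly measurable.** [folklore] -/
theorem aestronglyMeasurable_farIntegral (hVm : AEStronglyMeasurable V volume)
    (S : Set (EuclideanSpace ℝ (Fin 3))) :
    AEStronglyMeasurable (fun y => ∫ z in S, pressureKernel (y - z) (V z)) volume := by
  -- (the product-measure measurability is kept inside the proof: a top-level statement over
  -- `volume.prod (volume.restrict S)` trips the audit linter's `whnf` budget)
  have hV : AEMeasurable (fun q : EuclideanSpace ℝ (Fin 3) × EuclideanSpace ℝ (Fin 3) => V q.2)
      (((volume : Measure (EuclideanSpace ℝ (Fin 3)))).prod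
        ((volume : Measure (EuclideanSpace ℝ (Fin 3))).restrict S)) :=
    (hVm.restrict (s := S)).aemeasurable.comp_snd
  have h3 : AEMeasurable (fun q : EuclideanSpace ℝ (Fin 3) × EuclideanSpace ℝ (Fin 3) =>
      (q.1 - q.2, V q.2)) (((volume : Measure (EuclideanSpace ℝ (Fin 3)))).prod
        ((volume : Measure (EuclideanSpace ℝ (Fin 3))).restrict S)) :=
    (measurable_fst.sub measurable_snd).aemeasurable.prodMk hV
  exact (measurable_pressureKernel.comp_aemeasurable h3).aestronglyMeasurable.integral_prod_right'

end Measurability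

section FarHarmonic

/-- **The far kernel is weakly harmonic:** for `|z| ≥ R > 0`, `v ∈ ℝ³` and a test function `θ`
supported in `B_{R/2}`, `∫ K(y−z)(v) Δθ(y) dy = 0`.  On `B(z, R/4)ᶜ ⊇ supp θ`,
`K(·−z)(v) = −∂ᵥ∂ᵥΦ_{R/4}(·−z)` with the smooth regularised Newton kernel `Φ_ε` of the tree,
harmonic off `B̄(0, ε)`, so after two integrations by parts the integrand is
`θ · ∂ᵥ∂ᵥ(ΔΦ_ε)(·−z) = 0`. [folklore] -/
theorem integral_pressureKernel_mul_laplacian_eq_zero_of_far {R : ℝ} (hR : 0 < R)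
    {θ : EuclideanSpace ℝ (Fin 3) → ℝ} (hθ : ContDiff ℝ (⊤ : ℕ∞) θ) (hθc : HasCompactSupport θ)
    (hθR : tsupport θ ⊆ ball (0 : EuclideanSpace ℝ (Fin 3)) (R / 2))
    (v : EuclideanSpace ℝ (Fin 3)) {z : EuclideanSpace ℝ (Fin 3)} (hz : R ≤ ‖z‖) :
    ∫ y, pressureKernel (y - z) v * (Δ θ) y = 0 := by
  set ε : ℝ := R / 4 with hε
  have hε0 : 0 < ε := by positivity
  set Φ : EuclideanSpace ℝ (Fin 3) → ℝ := newtonReg ε with hΦ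
  have hΦs : ContDiff ℝ (⊤ : ℕ∞) Φ := contDiff_newtonReg ε
  -- `g y = −∂ᵥ∂ᵥΦ(y − z)`
  set g : EuclideanSpace ℝ (Fin 3) → ℝ :=
    fun y => -(FluidPDE.partialDeriv v (FluidPDE.partialDeriv v Φ) (y - z)) with hg
  have hdd : ContDiff ℝ (⊤ : ℕ∞) (FluidPDE.partialDeriv v (FluidPDE.partialDeriv v Φ)) := by
    have h1 : ContDiff ℝ (⊤ : ℕ∞) (FluidPDE.partialDeriv v Φ) :=
      contDiff_partialDeriv (n := ⊤) (by simpa using hΦs) v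
    exact contDiff_partialDeriv (n := ⊤) (by simpa using h1) v
  have hgs : ContDiff ℝ (⊤ : ℕ∞) g := (hdd.comp (contDiff_id.sub contDiff_const)).neg
  have hg2 : ContDiff ℝ 2 g := contDiff_infty.1 hgs 2
  have hθ2 : ContDiff ℝ 2 θ := contDiff_infty.1 hθ 2
  -- on the support of `θ`, `‖y − z‖ > ε` and `K(y−z)(v) = g y`
  have hfar : ∀ y ∈ tsupport θ, ε < ‖y - z‖ := by
    intro y hy
    have hy' : ‖y‖ < R / 2 := by simpa using hθR hy
    have : ‖z‖ - ‖y‖ ≤ ‖y - z‖ := by rw [norm_sub_rev]; exact norm_sub_norm_le z y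
    rw [hε]; linarith
  have hKg : ∀ y, pressureKernel (y - z) v * (Δ θ) y = g y * (Δ θ) y := by
    intro y
    by_cases hy : y ∈ tsupport θ
    · rw [hg]
      show _ = -(fderiv ℝ (fun w => fderiv ℝ Φ w v) (y - z) v) * Δ θ y
      rw [fderiv_fderiv_newtonReg_apply_eq_neg_pressureKernel hε0 (hfar y hy) v, neg_neg]
    · rw [laplacian_eq_zero_of_notMem_tsupport hy, mul_zero, mul_zero]
  simp_rw [hKg]
  -- two integrations by parts
  have hibp : ∫ y, g y * (Δ θ) y = ∫ y, θ y * (Δ g) y := by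
    have h := integral_mul_laplacian_comm hg2 hθ2 hθc
    -- `h : ∫ θ Δg = ∫ Δθ g`
    rw [h]
    exact integral_congr_ae (Eventually.of_forall fun y => mul_comm _ _)
  rw [hibp]
  -- `θ · Δg = 0` everywhere
  have hzero : ∀ y, θ y * (Δ g) y = 0 := by
    intro y
    by_cases hy : y ∈ tsupport θ
    · -- `Δg(y) = −(Δ ∂ᵥ∂ᵥΦ)(y − z) = −∂ᵥ∂ᵥ(ΔΦ)(y − z) = 0`
      have hyz := hfar y hy
      have h1 : (Δ g) y = -((Δ (FluidPDE.partialDeriv v (FluidPDE.partialDeriv v Φ))) (y - z)) := by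
        have e : g = -(fun y => FluidPDE.partialDeriv v (FluidPDE.partialDeriv v Φ) (y + (-z))) := by
          funext y; simp [hg, sub_eq_add_neg]
        rw [e, laplacian_neg, Pi.neg_apply, laplacian_comp_add_const, ← sub_eq_add_neg]
      have h2 : (Δ (FluidPDE.partialDeriv v (FluidPDE.partialDeriv v Φ))) (y - z) =
          FluidPDE.partialDeriv v (FluidPDE.partialDeriv v (Δ Φ)) (y - z) :=
        laplacian_partialDeriv_partialDeriv (contDiff_infty.1 hΦs 4) v (y - z)
      -- `ΔΦ` vanishes on a neighbourhood of `y − z`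
      have hopen : IsOpen {w : EuclideanSpace ℝ (Fin 3) | ε < ‖w‖} :=
        isOpen_lt continuous_const continuous_norm
      have hΔΦ0 : ∀ w ∈ {w : EuclideanSpace ℝ (Fin 3) | ε < ‖w‖}, Δ Φ w = 0 :=
        fun w hw => laplacian_newtonReg_eq_zero hε0 hw
      have h3 : FluidPDE.partialDeriv v (FluidPDE.partialDeriv v (Δ Φ)) (y - z) = 0 := by
        -- first derivative vanishes on the open set
        have hd1 : ∀ w ∈ {w : EuclideanSpace ℝ (Fin 3) | ε < ‖w‖},
            FluidPDE.partialDeriv v (Δ Φ) w = 0 := by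
          intro w hw
          have hloc : Δ Φ =ᶠ[𝓝 w] fun _ => (0 : ℝ) := by
            filter_upwards [hopen.mem_nhds hw] with w' hw'
            exact hΔΦ0 w' hw'
          show fderiv ℝ (Δ Φ) w v = 0
          rw [hloc.fderiv_eq, fderiv_const_apply]; rfl
        have hloc2 : FluidPDE.partialDeriv v (Δ Φ) =ᶠ[𝓝 (y - z)] fun _ => (0 : ℝ) := by
          filter_upwards [hopen.mem_nhds hyz] with w' hw'
          exact hd1 w' hw'
        show fderiv ℝ (FluidPDE.partialDeriv v (Δ Φ)) (y - z) v = 0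
        rw [hloc2.fderiv_eq, fderiv_const_apply]; rfl
      rw [h1, h2, h3, neg_zero, mul_zero]
    · rw [image_eq_zero_of_notMem_tsupport hy, zero_mul]
  simp_rw [hzero, integral_zero]

/-- **The far integral is weakly harmonic on `B_{R/2}`:** for `V ∈ L²`, `R > 0` and a test
function `θ` supported in `B_{R/2}`,
`∫ (∫_{|z| ≥ R} K(y−z)(V z) dz) Δθ(y) dy = 0` (Fubini — the integrand is dominated by
`|Δθ(y)| ‖V z‖²/(2π (R/2)³)` — and `integral_pressureKernel_mul_laplacian_eq_zero_of_far`).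
[folklore] -/
theorem integral_farIntegral_mul_laplacian_eq_zero (hVm : AEStronglyMeasurable V volume)
    (hV2 : Integrable (fun z => ‖V z‖ ^ 2) volume) {R : ℝ} (hR : 0 < R)
    {θ : EuclideanSpace ℝ (Fin 3) → ℝ} (hθ : ContDiff ℝ (⊤ : ℕ∞) θ) (hθc : HasCompactSupport θ)
    (hθR : tsupport θ ⊆ ball (0 : EuclideanSpace ℝ (Fin 3)) (R / 2)) :
    ∫ y, (∫ z in {z | R ≤ ‖z‖}, pressureKernel (y - z) (V z)) * (Δ θ) y = 0 := by
  set S : Set (EuclideanSpace ℝ (Fin 3)) := {z | R ≤ ‖z‖} with hS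
  have hSm : MeasurableSet S := measurableSet_le measurable_const measurable_norm
  have hθ2 : ContDiff ℝ 2 θ := contDiff_infty.1 hθ 2
  have hΔc : Continuous (Δ θ) := FluidPDE.continuous_laplacian hθ2
  have hΔs : HasCompactSupport (Δ θ) :=
    hθc.mono' fun x hx => by
      contrapose! hx
      simp [laplacian_eq_zero_of_notMem_tsupport hx]
  have hΔi : Integrable (Δ θ) volume := hΔc.integrable_of_hasCompactSupport hΔs
  -- the product integrand and its integrability on `ℝ³ × S`
  set F : EuclideanSpace ℝ (Fin 3) → EuclideanSpace ℝ (Fin 3) → ℝ :=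
    fun y z => pressureKernel (y - z) (V z) * (Δ θ) y with hF
  have hdist : ∀ y ∈ tsupport θ, ∀ z ∈ S, R / 2 ≤ ‖y - z‖ := by
    intro y hy z hz
    have hy' : ‖y‖ < R / 2 := by simpa using hθR hy
    have : ‖z‖ - ‖y‖ ≤ ‖y - z‖ := by rw [norm_sub_rev]; exact norm_sub_norm_le z y
    have hz' : R ≤ ‖z‖ := hz
    linarith
  have hFint : Integrable (uncurry F)
      ((volume : Measure (EuclideanSpace ℝ (Fin 3))).prod (volume.restrict S)) := by
    have hmeas : AEStronglyMeasurable (uncurry F)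
        ((volume : Measure (EuclideanSpace ℝ (Fin 3))).prod (volume.restrict S)) := by
      have hV : AEMeasurable (fun q : EuclideanSpace ℝ (Fin 3) × EuclideanSpace ℝ (Fin 3) => V q.2)
          (((volume : Measure (EuclideanSpace ℝ (Fin 3)))).prod
            ((volume : Measure (EuclideanSpace ℝ (Fin 3))).restrict S)) :=
        (hVm.restrict (s := S)).aemeasurable.comp_snd
      have h3 : AEMeasurable (fun q : EuclideanSpace ℝ (Fin 3) × EuclideanSpace ℝ (Fin 3) =>
          (q.1 - q.2, V q.2)) (((volume : Measure (EuclideanSpace ℝ (Fin 3)))).prod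
            ((volume : Measure (EuclideanSpace ℝ (Fin 3))).restrict S)) :=
        (measurable_fst.sub measurable_snd).aemeasurable.prodMk hV
      refine ((measurable_pressureKernel.comp_aemeasurable h3).mul ?_).aestronglyMeasurable
      exact (hΔc.measurable.comp measurable_fst).aemeasurable
    have hdom : Integrable (fun q : EuclideanSpace ℝ (Fin 3) × EuclideanSpace ℝ (Fin 3) =>
        |(Δ θ) q.1| * (‖V q.2‖ ^ 2 / (2 * Real.pi * (R / 2) ^ 3)))
        ((volume : Measure (EuclideanSpace ℝ (Fin 3))).prod (volume.restrict S)) :=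
      Integrable.mul_prod hΔi.abs ((hV2.restrict (s := S)).div_const _)
    refine hdom.mono' hmeas ?_
    have hzS : ∀ᵐ q ∂((volume : Measure (EuclideanSpace ℝ (Fin 3))).prod (volume.restrict S)),
        q.2 ∈ S := by
      refine (Measure.quasiMeasurePreserving_snd).ae ?_
      exact ae_restrict_mem hSm
    filter_upwards [hzS] with q hq
    simp only [uncurry, hF, norm_mul, Real.norm_eq_abs]
    by_cases hy : q.1 ∈ tsupport θ
    · rw [mul_comm]
      refine mul_le_mul_of_nonneg_left ?_ (abs_nonneg _)
      exact abs_pressureKernel_apply_le_of_dist (by positivity) fun _ => hdist q.1 hy q.2 hq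
    · rw [laplacian_eq_zero_of_notMem_tsupport hy, abs_zero, mul_zero]
      positivity
  -- Fubini
  have hswap := integral_integral_swap hFint
  have hinner : ∀ y, (∫ z in S, pressureKernel (y - z) (V z)) * (Δ θ) y = ∫ z in S, F y z := by
    intro y
    rw [hF]
    exact (integral_mul_const ((Δ θ) y) _).symm
  simp_rw [hinner]
  rw [hswap]
  have hz0 : ∀ z ∈ S, ∫ y, F y z = 0 := fun z hz =>
    integral_pressureKernel_mul_laplacian_eq_zero_of_far hR hθ hθc hθR (V z) hz
  rw [setIntegral_congr_fun hSm hz0, integral_zero]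

end FarHarmonic

section Poisson

/-- The Hessian of a test function vanishes off its topological support. [folklore] -/
theorem fderiv_fderiv_eq_zero_of_notMem_tsupport {θ : EuclideanSpace ℝ (Fin 3) → ℝ}
    {y : EuclideanSpace ℝ (Fin 3)} (hy : y ∉ tsupport θ) : fderiv ℝ (fderiv ℝ θ) y = 0 :=
  image_eq_zero_of_notMem_tsupport fun h =>
    hy (tsupport_fderiv_subset (𝕜 := ℝ) (tsupport_fderiv_subset (𝕜 := ℝ) h))

/-- **`Q_R` solves the weak Poisson equation on `B_{R/2}`.**  For `V ∈ L²` with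
`V·1_{B_R} ∈ L³` and a test function `θ` supported in `B_{R/2}`,
`∫ (Π[V·1_{B_R}] + ∫_{|z| ≥ R} K(·−z)(V z)) Δθ = −∫ D²θ(V, V)`
(the Riesz pressure of the near field solves the Poisson equation with source `V·1_{B_R}`, which
is `V` on the support of `θ`; the far integral is weakly harmonic there).
[cite: Tsai1998, (2.5) and Lemma 2.1 proof (p. 34)] -/
theorem integral_scaleQ_mul_laplacian (hVm : AEStronglyMeasurable V volume)
    (hV2 : Integrable (fun z => ‖V z‖ ^ 2) volume) {R : ℝ} (hR : 0 < R)
    (hV3R : MemLp ((ball (0 : EuclideanSpace ℝ (Fin 3)) R).indicator V) 3 volume)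
    {θ : EuclideanSpace ℝ (Fin 3) → ℝ} (hθ : ContDiff ℝ (⊤ : ℕ∞) θ) (hθc : HasCompactSupport θ)
    (hθR : tsupport θ ⊆ ball (0 : EuclideanSpace ℝ (Fin 3)) (R / 2)) :
    ∫ y, (rieszPressure ((ball (0 : EuclideanSpace ℝ (Fin 3)) R).indicator V) y +
        ∫ z in {z | R ≤ ‖z‖}, pressureKernel (y - z) (V z)) * (Δ θ) y =
      -∫ y, fderiv ℝ (fderiv ℝ θ) y (V y) (V y) := by
  set U := (ball (0 : EuclideanSpace ℝ (Fin 3)) R).indicator V with hU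
  set Far : EuclideanSpace ℝ (Fin 3) → ℝ := fun y => ∫ z in {z | R ≤ ‖z‖}, pressureKernel (y - z) (V z)
    with hFar
  have hθ2 : ContDiff ℝ 2 θ := contDiff_infty.1 hθ 2
  have hΔc : Continuous (Δ θ) := FluidPDE.continuous_laplacian hθ2
  have hΔs : HasCompactSupport (Δ θ) :=
    hθc.mono' fun x hx => by
      contrapose! hx
      simp [laplacian_eq_zero_of_notMem_tsupport hx]
  have hΔi : Integrable (Δ θ) volume := hΔc.integrable_of_hasCompactSupport hΔs
  have h32 : (1 : ℝ≥0∞) ≤ 3 / 2 := by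
    rw [ENNReal.le_div_iff_mul_le (Or.inl two_ne_zero) (Or.inl ENNReal.ofNat_ne_top)]; norm_num
  -- integrability of the two products
  have hQi : Integrable (fun y => rieszPressure U y * (Δ θ) y) volume := by
    have h := ((memLp_rieszPressure hV3R).locallyIntegrable h32).integrable_smul_left_of_hasCompactSupport
      hΔc hΔs
    simpa [smul_eq_mul, mul_comm] using h
  have hFari : Integrable (fun y => Far y * (Δ θ) y) volume := by
    -- replace `Far` by its restriction to `B̄_{R/2}`, which is bounded
    set D : Set (EuclideanSpace ℝ (Fin 3)) := closedBall 0 (R / 2) with hD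
    have heq : (fun y => Far y * (Δ θ) y) = fun y => D.indicator Far y * (Δ θ) y := by
      funext y
      by_cases hy : y ∈ D
      · rw [indicator_of_mem hy]
      · have hy' : y ∉ tsupport θ := fun h => hy (ball_subset_closedBall (hθR h))
        rw [laplacian_eq_zero_of_notMem_tsupport hy', mul_zero, mul_zero]
    rw [heq]
    refine hΔi.bdd_mul ((aestronglyMeasurable_farIntegral hVm _).indicator measurableSet_closedBall)
      (c := 8 * (∫ z, ‖V z‖ ^ 2) / (2 * Real.pi * R ^ 3)) (Eventually.of_forall fun y => ?_)
    by_cases hy : y ∈ D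
    · rw [indicator_of_mem hy, Real.norm_eq_abs]
      have hy' : ‖y‖ ≤ R / 2 := by simpa [hD] using hy
      exact abs_setIntegral_pressureKernel_far_le hV2 hR hy'
    · rw [indicator_of_notMem hy, norm_zero]
      exact div_nonneg (mul_nonneg (by norm_num) (integral_nonneg fun z => by positivity))
        (by positivity)
  -- split the integral
  have hsplit : ∫ y, (rieszPressure U y + Far y) * (Δ θ) y =
      (∫ y, rieszPressure U y * (Δ θ) y) + ∫ y, Far y * (Δ θ) y := by
    rw [← integral_add hQi hFari]
    exact integral_congr_ae (Eventually.of_forall fun y => add_mul _ _ _)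
  rw [hsplit, integral_rieszPressure_mul_laplacian hV3R hθ hθc,
    integral_farIntegral_mul_laplacian_eq_zero hVm hV2 hR hθ hθc hθR, add_zero]
  congr 1
  refine integral_congr_ae (Eventually.of_forall fun y => ?_)
  dsimp only
  by_cases hy : y ∈ ball (0 : EuclideanSpace ℝ (Fin 3)) R
  · rw [hU, indicator_of_mem hy]
  · have hy' : y ∉ tsupport θ := fun h => hy (ball_subset_ball (by linarith) (hθR h))
    rw [fderiv_fderiv_eq_zero_of_notMem_tsupport hy']
    simp

end Poisson

end Summit.NavierStokesRegularity.NavierStokesRegularity.Theorems.PowerGaugeEulerLiouville
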